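import Summits.CriticalPhenomena.PercolationContinuityZ3.Theorems.Transplant.AutChartTreeChart
import HarnessLib

/-!
# The TREE CHART of an action with finitely many orbits, III: COARSE FRAMES (chart-translating automorphisms with finitely many residue types) and
# the packaged customer statement `∃ ψ types M, Skelφ.Lip G ψ ∧ Skelφ.QStepsN G ψ M ∧ Skelφ.Frames G ψ types`

builds on p205010 (kernel theorem, internal audit signed; external expert review pending) — nothing in this file uses p205010 and nothing here is a
percolation statement or a claim about any node.  Lane `prim-bschramm`, seat `prim-bschramm-p5` gen 28 (refuter / sharpness seat; R2′ finding F3,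
P5-SHARPNESS §60.3 (vi)).  Helper file (`--supports stmt-CriticalPhenomena-4575 --as helper`); PROOFS ONLY (def-free; the residue types are packaged
existentially).

WHY.  «AutChartTreeChart» gives, for every tree datum `D`, the coarse chart `D.coarse = ⌊D.chart / N⌋` with `Skelφ.Lip` and the exact-footprint
quasi-steps `Skelφ.QStepsN` — the step field and the Lipschitz field of the quasi-step carrier the design owner adopted (lane INBOX 2026-08-27 06:01Z:
(ι) := `Skelφ.QStepsN`).  The carrier's third structural field is FRAMES: every vertex is the image of one of finitely many base vertices under an
automorphism translating the chart EXACTLY.  The fine chart is translated by every `a ∈ A` (by `c a`); the coarse chart is translated exactly by the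
finite-index subgroup `{a : N ∣ c a}`, so the residue classes `(type, chart mod N)` — at most `|reps| · N²` of them — serve as types.
* §1 `coarse_smul_of_dvd`: `a` with `N ∣ c a` translates the coarse chart by `c a / N`;
* §2 **`exists_coarseFrames : ∃ T : Finset V, Skelφ.Frames G D.coarse T`** (one vertex per realised residue class; the frame of `v` is `osec v · (osec t)⁻¹`
  for the chosen `t` of its class);
* §3 **`exists_lip_qStepsN_frames_of_finite_orbits`**: for every action by automorphisms of a connected locally finite graph with finitely many orbits and
  a character of rank two killing one stabiliser there are `ψ : V → ℤ²`, `types`, `M`, `N ≥ 1` and the re-based character `c'` with `Skelφ.Lip G ψ`,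
  `Skelφ.QStepsN G ψ M`, `Skelφ.Frames G ψ types`, and `ψ (a • w) = ψ w + c' a / N` whenever `N ∣ c' a` (in particular `ψ` is `ker c`-INVARIANT — the
  input of the fattened-cylinder construction (κ″)).  This is the customer side of the quasi-step rung, free of any step hypothesis.
[cite: KozmaNitzan2024, §4 p. 15 (boxes and their translates), p. 16 (Lemma 8)] [cite: MartineauTassion2017, §3.2] [cite: BenjaminiSchramm1996, §2]
-/

noncomputable section

namespace Summit.CriticalPhenomena.PercolationContinuityZ3.Theorems.Transplant

open SimpleGraph Literature.Barriers.CriticalPhenomena Literature.Probability.LatticeModels Literature.Probability.Percolation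
open scoped Classical

namespace AutChart

variable {V : Type} {G : SimpleGraph V} {A : Type} [Group A] [MulAction A V]

namespace TreeDatum

variable (D : TreeDatum G A) [G.LocallyFinite]

/-! ## §1 Exact coarse translations -/

omit [G.LocallyFinite] in
/-- `chart v = c (osec v)` (the chart of a vertex is the value of its section). [folklore] -/
theorem chart_eq_toAdd_osec (v : V) : D.chart v = Multiplicative.toAdd (D.c (osec D.cover v)) := rfl

/-- **An element whose value is divisible by `N` translates the coarse chart EXACTLY by `c a / N`.** [cite: KozmaNitzan2024, §4 p. 15 (translates of boxes)] -/
theorem coarse_smul_of_dvd (a : A) (hdvd : ∀ j : Fin 2, (D.N : ℤ) ∣ Multiplicative.toAdd (D.c a) j) (w : V) :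
    D.coarse (a • w) = D.coarse w + fun j => Multiplicative.toAdd (D.c a) j / (D.N : ℤ) := by
  funext j
  rw [Pi.add_apply, D.coarse_apply, D.coarse_apply, D.chart_smul, Pi.add_apply, add_comm (Multiplicative.toAdd (D.c a) j),
    Int.add_ediv_of_dvd_right (hdvd j)]

/-- **Kernel elements preserve the coarse chart.** [folklore] -/
theorem coarse_smul_of_ker (a : A) (ha : D.c a = 1) (w : V) : D.coarse (a • w) = D.coarse w := by
  rw [D.coarse_smul_of_dvd a (fun j => by rw [ha, toAdd_one, Pi.zero_apply]; exact dvd_zero _)]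
  funext j
  rw [Pi.add_apply, ha, toAdd_one, Pi.zero_apply, Int.zero_ediv, add_zero]

/-! ## §2 Coarse frames with residue types -/

/-- **COARSE FRAMES**: there is a finite set `T` of base vertices such that every vertex `v` is the image of some `t ∈ T` under an automorphism translating
the COARSE chart exactly (`Skelφ.Frames G D.coarse T`).  `T` has one vertex per realised class `(type, chart mod N)` (at most `|reps|·N²` classes); the
frame of `v` is the action of `osec v · (osec t)⁻¹`, whose value `chart v − chart t` is divisible by `N`. [cite: KozmaNitzan2024, §4 p. 16 (Lemma 8)] -/
theorem exists_coarseFrames : ∃ T : Finset V, Skelφ.Frames G D.coarse T := by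
  have hN := D.N_pos
  -- the class of a vertex: its type and its chart residues mod `N`
  let cls : V → V × (ℤ × ℤ) := fun v => (otyp D.cover v, (D.chart v 0 % (D.N : ℤ), D.chart v 1 % (D.N : ℤ)))
  let pick : V × (ℤ × ℤ) → V := fun q => if h : ∃ v : V, cls v = q then Classical.choose h else q.1
  have hpick : ∀ v : V, cls (pick (cls v)) = cls v := fun v => by
    have h : ∃ v' : V, cls v' = cls v := ⟨v, rfl⟩
    simp only [pick, dif_pos h]
    exact Classical.choose_spec h
  let dom : Finset (V × (ℤ × ℤ)) := D.reps ×ˢ (Finset.Ico (0 : ℤ) D.N ×ˢ Finset.Ico (0 : ℤ) D.N)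
  have hcls : ∀ v : V, cls v ∈ dom := fun v => by
    simp only [cls, dom, Finset.mem_product, Finset.mem_Ico]
    exact ⟨otyp_mem D.cover v, ⟨Int.emod_nonneg _ hN.ne', Int.emod_lt_of_pos _ hN⟩, ⟨Int.emod_nonneg _ hN.ne', Int.emod_lt_of_pos _ hN⟩⟩
  refine ⟨dom.image pick, fun v => ?_⟩
  set t : V := pick (cls v) with ht_def
  have ht : cls t = cls v := hpick v
  have htyp : otyp D.cover t = otyp D.cover v := congrArg Prod.fst ht
  have hres : ∀ j : Fin 2, (D.N : ℤ) ∣ D.chart v j - D.chart t j := by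
    have h2 := congrArg Prod.snd ht
    simp only [cls, Prod.mk.injEq] at h2
    intro j
    fin_cases j
    · exact Int.ModEq.dvd h2.1
    · exact Int.ModEq.dvd h2.2
  -- the frame: `osec v · (osec t)⁻¹`
  set g : A := osec D.cover v * (osec D.cover t)⁻¹ with hg
  have hgt : g • t = v := by
    rw [hg, mul_smul]
    have h1 : (osec D.cover t)⁻¹ • t = otyp D.cover t := by rw [inv_smul_eq_iff, osec_smul]
    rw [h1, htyp, osec_smul]
  have hval : Multiplicative.toAdd (D.c g) = D.chart v - D.chart t := by
    rw [hg, map_mul, map_inv, toAdd_mul, toAdd_inv, D.chart_eq_toAdd_osec v, D.chart_eq_toAdd_osec t, sub_eq_add_neg]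
  have hdvd : ∀ j : Fin 2, (D.N : ℤ) ∣ Multiplicative.toAdd (D.c g) j := fun j => by rw [hval, Pi.sub_apply]; exact hres j
  refine ⟨t, Finset.mem_image_of_mem _ (hcls v), smulIso D.act g, hgt, fun w => ?_⟩
  rw [smulIso_apply, D.coarse_smul_of_dvd g hdvd]
  congr 1
  funext j
  rw [Pi.sub_apply, D.coarse_apply, D.coarse_apply, hval, Pi.sub_apply]
  -- `chart v = chart t + (chart v − chart t)` with the difference divisible by `N`
  obtain ⟨m, hm⟩ := hres j
  have e : D.chart v j = D.chart t j + (D.N : ℤ) * m := by rw [← hm]; ring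
  rw [hm, e, Int.add_mul_ediv_left _ _ hN.ne', Int.mul_ediv_cancel_left _ hN.ne']
  ring

end TreeDatum

/-! ## §3 The packaged customer statement -/

/-- **THE CUSTOMER SIDE OF THE QUASI-STEP RUNG, STEP-FREE**: a connected locally finite graph with an action by automorphisms having finitely many orbits
and a character `c : A → ℤ²` of rank two killing one stabiliser carries an integer chart `ψ` with `Skelφ.Lip G ψ` (1-Lipschitz), `Skelφ.QStepsN G ψ M`
(EXACT-footprint quasi-steps) and `Skelφ.Frames G ψ types` (finitely many chart-translating frame types), together with a scale `N ≥ 1` and the re-based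
character `c' = rebase ∘ c` such that every `a` with `N ∣ c' a` translates `ψ` by `c' a / N` — in particular `ker c` fixes `ψ`.  (Tree chart of
«AutChartTreeChart» + coarse frames above.) [cite: KozmaNitzan2024, §4 p. 16 (Lemma 8: good coordinates)] [cite: MartineauTassion2017, §3.2]
[cite: BenjaminiSchramm1996, §2 (almost transitive graphs)] -/
theorem exists_lip_qStepsN_frames_of_finite_orbits [G.LocallyFinite] (hact : IsActionByAut G A) (hc : G.Connected) (reps₀ : Finset V)
    (hcover₀ : ∀ w : V, ∃ a : A, ∃ r ∈ reps₀, a • r = w) (c : A →* Multiplicative (Site 2)) {t : V}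
    (hstab : ∀ h ∈ MulAction.stabilizer A t, c h = 1)
    (hrank : ∃ a b : A, MaxArea.det2 (Multiplicative.toAdd (c a)) (Multiplicative.toAdd (c b)) ≠ 0) :
    ∃ (ψ : V → Site 2) (types : Finset V) (M N : ℕ) (u w : Site 2), 1 ≤ N ∧ Skelφ.Lip G ψ ∧ Skelφ.QStepsN G ψ M ∧ Skelφ.Frames G ψ types ∧
      (∀ a : A, (∀ j : Fin 2, (N : ℤ) ∣ MaxArea.rebase u w (Multiplicative.toAdd (c a)) j) →
        ∀ x : V, ψ (a • x) = ψ x + fun j => MaxArea.rebase u w (Multiplicative.toAdd (c a)) j / (N : ℤ)) ∧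
      (∀ a : A, c a = 1 → ∀ x : V, ψ (a • x) = ψ x) := by
  obtain ⟨D, u, w, hc', -⟩ := exists_treeDatum hact hc reps₀ hcover₀ c hstab hrank
  obtain ⟨T, hT⟩ := D.exists_coarseFrames
  have hN1 : 1 ≤ D.N := by have := D.N_pos; exact_mod_cast this
  have hval : ∀ a : A, Multiplicative.toAdd (D.c a) = MaxArea.rebase u w (Multiplicative.toAdd (c a)) := fun a => by rw [hc']; rfl
  refine ⟨D.coarse, T, (D.R + 1) * D.reps.card, D.N, u, w, hN1, D.coarse_lip, D.coarse_qStepsN, hT, fun a ha x => ?_, fun a ha x => ?_⟩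
  · have hdvd : ∀ j : Fin 2, (D.N : ℤ) ∣ Multiplicative.toAdd (D.c a) j := fun j => by rw [hval]; exact ha j
    rw [D.coarse_smul_of_dvd a hdvd]
    simp only [hval]
  · exact D.coarse_smul_of_ker a (by rw [hc', MonoidHom.comp_apply, ha, map_one]) x

end AutChart

end Summit.CriticalPhenomena.PercolationContinuityZ3.Theorems.Transplant

end
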